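import Summits.KontsevichZagierPeriods.KontsevichZagierPeriods.Theses.FurushoPentagon
import Literature.NumberTheory.Transcendental.DrinfeldAssociatorRegularisation
import Literature.NumberTheory.Transcendental.AssociatorsHexagonProofs
import Literature.NumberTheory.Transcendental.DrinfeldAssociatorProofs
import Literature.NumberTheory.Transcendental.AssociatorsProofs
import Literature.NumberTheory.Transcendental.AssociatorsEval
import Literature.NumberTheory.Transcendental.KZLogCalculusProofs
import Summits.KontsevichZagierPeriods.KontsevichZagierPeriods.Theorems.FurushoPentagonPentagonInKZGroupLike
import Summits.KontsevichZagierPeriods.KontsevichZagierPeriods.Theorems.FurushoPentagonPentagonInKZPathFamilies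
import Summits.KontsevichZagierPeriods.KontsevichZagierPeriods.Theorems.FurushoPentagonPentagonInKZHalfEdgeUniversal
import Summits.KontsevichZagierPeriods.KontsevichZagierPeriods.Theorems.FurushoPentagonPentagonInKZShuffleProduct
import Summits.KontsevichZagierPeriods.KontsevichZagierPeriods.Theorems.FurushoPentagonPentagonInKZSimplexToCube
import Summits.KontsevichZagierPeriods.KontsevichZagierPeriods.Theorems.FurushoPentagonPentagonInKZRegEndCons
import Summits.KontsevichZagierPeriods.KontsevichZagierPeriods.Theorems.FurushoPentagonPentagonInKZOmegaCommute
import Summits.KontsevichZagierPeriods.KontsevichZagierPeriods.Theorems.FurushoPentagonPentagonInKZPolyIdentity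

/-!
# `PentagonInKZ`: algebra of the assembly (truncated Drinfeld–Kohno algebra, group telescoping)

Helper for the crux assembly `FurushoPentagonPentagonInKZ.lean` (stmt-KontsevichZagierPeriods-11348,
line `logfree-gauge-corner-flatness`; registered helper `pentagon_of_corners_group`): units and
commutation of truncated exponentials and truncated evaluations of group-like series, single-letter
evaluations, and the group-theoretic telescoping `pentagon_of_corners_group` — from the five corner
identities, the two half-edge factorisations and the chart identity to Drinfeld's pentagon word.
[cite: Drinfeld1991, §2]
-/

noncomputable section

open Literature.NumberTheory.Transcendental

namespace Summit.KontsevichZagierPeriods.FurushoPentagon.PentagonInKZ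

/-! ## 2. Algebra in the truncated Drinfeld–Kohno algebra -/

section Algebra

variable {R : Type} [CommRing R] [Algebra ℚ R] {N : ℕ}

local notation "DK" => DrinfeldKohnoTrunc R (Fin 4) N

omit [Algebra ℚ R] in
/-- An element commuting with every value of the substitution commutes with the truncated
evaluation of any series. [folklore] -/
theorem commute_evalTrunc {α : Type} [Fintype α] {A : Type} [Ring A] [Algebra R A] {x : A}
    {v : α → A} (hv : ∀ i, Commute x (v i)) (n : ℕ) (S : NCSeries α R) :
    Commute x (NCSeries.evalTrunc n v S) := by
  unfold NCSeries.evalTrunc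
  refine Commute.sum_right _ _ _ fun k _ => Commute.sum_right _ _ _ fun f _ => ?_
  refine Commute.smul_right ?_ _
  exact Commute.list_prod_right _ _ fun y hy => by
    obtain ⟨i, -, rfl⟩ := List.mem_map.mp hy
    exact hv i

omit [Algebra ℚ R] in
/-- The truncated evaluation of a series with constant term `1` at weight-one values is a unit.
[folklore] -/
theorem isUnit_evalTrunc_of_mem {α : Type} [Fintype α] [DecidableEq α] {v : α → DK}
    (hv : ∀ i, v i ∈ (DrinfeldKohnoTrunc.genSpan : Submodule R DK)) {S : NCSeries α R}
    (hS : S [] = 1) : IsUnit (NCSeries.evalTrunc N v S) :=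
  NCSeries.isUnit_evalTrunc N v (DrinfeldKohnoTrunc.prod_map_eq_zero_of_mem_genSpan v hv) hS

/-- `e^{r x} e^{r y} = e^{r (x + y)}` for commuting weight-one `x, y`. [folklore] -/
theorem truncExp_smul_mul_truncExp_smul {x y : DK} (hxy : Commute x y)
    (hx : x ∈ (DrinfeldKohnoTrunc.genSpan : Submodule R DK))
    (hy : y ∈ (DrinfeldKohnoTrunc.genSpan : Submodule R DK)) (r : R) :
    truncExp R N (r • x) * truncExp R N (r • y) = truncExp R N (r • (x + y)) := by
  rw [smul_add, ← truncExp_add_of_commute N ((hxy.smul_left r).smul_right r)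
    (DrinfeldKohnoTrunc.pow_eq_zero_of_mem_genSpan (Submodule.smul_mem _ _ hx))
    (DrinfeldKohnoTrunc.pow_eq_zero_of_mem_genSpan (Submodule.smul_mem _ _ hy))
    (DrinfeldKohnoTrunc.pow_eq_zero_of_mem_genSpan
      (Submodule.add_mem _ (Submodule.smul_mem _ _ hx) (Submodule.smul_mem _ _ hy)))]

/-- `e^{r x}` is a unit for weight-one `x`. [folklore] -/
theorem isUnit_truncExp_smul {x : DK} (hx : x ∈ (DrinfeldKohnoTrunc.genSpan : Submodule R DK))
    (r : R) : IsUnit (truncExp R N (r • x)) :=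
  have hn : (r • x) ^ (N + 1) = 0 :=
    DrinfeldKohnoTrunc.pow_eq_zero_of_mem_genSpan (Submodule.smul_mem _ _ hx)
  ⟨⟨truncExp R N (r • x), truncExp R N (-(r • x)), truncExp_mul_truncExp_neg N hn,
    truncExp_neg_mul_truncExp N hn⟩, rfl⟩

/-- `e^{r x}` commutes with whatever `x` commutes with. [folklore] -/
theorem commute_truncExp_smul {x y : DK} (h : Commute x y) (r : R) :
    Commute (truncExp R N (r • x)) y :=
  (Commute.truncExp_right (h.symm.smul_right r) N).symm

/-! ### Central shifts of group-like three-letter series evaluated at `![x, y, 0]` -/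

omit [Algebra ℚ R] in
/-- `![x + z, y, 0] = ![x, y, 0] + ![z, 0, 0]`. [folklore] -/
theorem vec3_add_left {A : Type} [AddMonoid A] (x y z : A) :
    (![x + z, y, 0] : Fin 3 → A) = ![x, y, 0] + ![z, 0, 0] := by
  funext i; fin_cases i <;> simp

omit [Algebra ℚ R] in
/-- `![x, y + z, 0] = ![x, y, 0] + ![0, z, 0]`. [folklore] -/
theorem vec3_add_right {A : Type} [AddMonoid A] (x y z : A) :
    (![x, y + z, 0] : Fin 3 → A) = ![x, y, 0] + ![0, z, 0] := by
  funext i; fin_cases i <;> simp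

omit [Algebra ℚ R] in
/-- The inner sum of `evalTrunc` at a substitution supported on ONE letter `ℓ` collapses to the
power word `ℓⁿ`. [folklore] -/
theorem sum_fin_single_letter {A : Type} [Ring A] [Algebra R A] (S : NCSeries (Fin 3) R)
    (v : Fin 3 → A) (ℓ : Fin 3) (hv : ∀ i, i ≠ ℓ → v i = 0) (n : ℕ) :
    ∑ f : Fin n → Fin 3, S (List.ofFn f) • ((List.ofFn f).map v).prod =
      S (List.replicate n ℓ) • (v ℓ) ^ n := by
  rw [Finset.sum_eq_single_of_mem (fun _ => ℓ) (Finset.mem_univ _) ?_]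
  · simp [List.ofFn_const, List.map_replicate, List.prod_replicate]
  · intro f _ hf
    have : ∃ i, f i ≠ ℓ := by
      by_contra h
      push Not at h
      exact hf (funext h)
    obtain ⟨i, hi⟩ := this
    have h0 : ((List.ofFn f).map v).prod = 0 := by
      apply List.prod_eq_zero
      rw [List.mem_map]
      exact ⟨f i, by simp [List.mem_ofFn], hv _ hi⟩
    rw [h0, smul_zero]

/-- **Left shift evaluates to `1`**: `S(z, 0, 0) = 1` for a group-like `S` with `S(0) = 0`.
[folklore] -/
theorem evalTrunc_vec3_single₀ {S : NCSeries (Fin 3) R} (hS : NCSeries.IsGroupLike S)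
    (h0 : S [0] = 0) (z : DK) : NCSeries.evalTrunc N (![z, 0, 0] : Fin 3 → DK) S = 1 := by
  unfold NCSeries.evalTrunc
  rw [Finset.sum_eq_single_of_mem 0 (by simp) ?_]
  · simp [hS.1]
  · intro n _ hn
    rw [sum_fin_single_letter S _ 0 (fun i hi => by fin_cases i <;> simp_all)]
    rw [hS.apply_replicate_eq_zero h0 n hn, zero_smul]

/-- Coefficients of a group-like series on the powers of a letter: `S(ℓᵏ) = S(ℓ)ᵏ/k!`.
[cite: Reutenauer1993, Thm 3.2] -/
theorem IsGroupLike.apply_replicate {α : Type} [DecidableEq α] {S : NCSeries α R}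
    (hS : NCSeries.IsGroupLike S) (ℓ : α) :
    ∀ k : ℕ, S (List.replicate k ℓ) = algebraMap ℚ R (1 / (k.factorial : ℚ)) * S [ℓ] ^ k
  | 0 => by simp [hS.1]
  | k + 1 => by
    have h := hS.apply_singleton_mul_replicate ℓ k
    rw [IsGroupLike.apply_replicate hS ℓ k] at h
    have hinv : algebraMap ℚ R (1 / (k + 1 : ℚ)) * ((k + 1 : ℕ) : R) = 1 := by
      rw [← map_natCast (algebraMap ℚ R), ← map_mul, ← map_one (algebraMap ℚ R)]
      congr 1; push_cast; field_simp
    have hk : (k.factorial : ℚ) ≠ 0 := by positivity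
    have hq : algebraMap ℚ R (1 / (k + 1 : ℚ)) * algebraMap ℚ R (1 / (k.factorial : ℚ)) =
        algebraMap ℚ R (1 / ((k + 1).factorial : ℚ)) := by
      rw [← map_mul]; congr 1; rw [Nat.factorial_succ]; push_cast; field_simp
    calc S (List.replicate (k + 1) ℓ)
        = algebraMap ℚ R (1 / (k + 1 : ℚ)) * (((k + 1 : ℕ) : R) * S (List.replicate (k + 1) ℓ)) := by
          rw [← mul_assoc, hinv, one_mul]
      _ = algebraMap ℚ R (1 / (k + 1 : ℚ)) *
            (S [ℓ] * (algebraMap ℚ R (1 / (k.factorial : ℚ)) * S [ℓ] ^ k)) := by rw [h]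
      _ = algebraMap ℚ R (1 / ((k + 1).factorial : ℚ)) * S [ℓ] ^ (k + 1) := by
          rw [← hq]; ring

/-- **Right shift evaluates to an exponential**: `S(0, z, 0) = e^{S(1) z}` for a group-like `S`
and weight-one `z`. [cite: Reutenauer1993, Thm 3.2] -/
theorem evalTrunc_vec3_single₁ {S : NCSeries (Fin 3) R} (hS : NCSeries.IsGroupLike S) (z : DK) :
    NCSeries.evalTrunc N (![0, z, 0] : Fin 3 → DK) S = truncExp R N (S [1] • z) := by
  unfold NCSeries.evalTrunc truncExp
  refine Finset.sum_congr rfl fun n _ => ?_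
  rw [sum_fin_single_letter S _ 1 (fun i hi => by fin_cases i <;> simp_all),
    IsGroupLike.apply_replicate hS 1 n, smul_pow, smul_smul]
  simp

/-- **Left central shift** `S(x + z, y, 0) = S(x, y, 0)` for a group-like `S` with `S(0) = 0`,
`z` weight-one commuting with `x, y`. [cite: Furusho2010, Lemma 5 (proof)] -/
theorem evalTrunc_vec3_add_left {S : NCSeries (Fin 3) R} (hS : NCSeries.IsGroupLike S)
    (h0 : S [0] = 0) {x y z : DK} (hx : x ∈ (DrinfeldKohnoTrunc.genSpan : Submodule R DK))
    (hy : y ∈ (DrinfeldKohnoTrunc.genSpan : Submodule R DK))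
    (hz : z ∈ (DrinfeldKohnoTrunc.genSpan : Submodule R DK)) (hzx : Commute z x) (hzy : Commute z y) :
    NCSeries.evalTrunc N (![x + z, y, 0] : Fin 3 → DK) S =
      NCSeries.evalTrunc N (![x, y, 0] : Fin 3 → DK) S := by
  rw [vec3_add_left, hS.evalTrunc_add DrinfeldKohnoTrunc.genSpan
    DrinfeldKohnoTrunc.list_prod_eq_zero_of_mem_genSpan (v₁ := ![x, y, 0]) (v₂ := ![z, 0, 0])
    (fun i => by fin_cases i <;> simp [hx, hy]) (fun i => by fin_cases i <;> simp [hz])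
    (fun i j => by fin_cases i <;> fin_cases j <;> simp [hzx.symm, hzy.symm]),
    evalTrunc_vec3_single₀ hS h0, mul_one]

/-- **Right central shift** `S(x, y + z, 0) = S(x, y, 0) e^{S(1) z}` for a group-like `S`,
`z` weight-one commuting with `x, y`. [cite: Furusho2010, Lemma 5 (proof)] -/
theorem evalTrunc_vec3_add_right {S : NCSeries (Fin 3) R} (hS : NCSeries.IsGroupLike S)
    {x y z : DK} (hx : x ∈ (DrinfeldKohnoTrunc.genSpan : Submodule R DK))
    (hy : y ∈ (DrinfeldKohnoTrunc.genSpan : Submodule R DK))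
    (hz : z ∈ (DrinfeldKohnoTrunc.genSpan : Submodule R DK)) (hzx : Commute z x) (hzy : Commute z y) :
    NCSeries.evalTrunc N (![x, y + z, 0] : Fin 3 → DK) S =
      NCSeries.evalTrunc N (![x, y, 0] : Fin 3 → DK) S * truncExp R N (S [1] • z) := by
  rw [vec3_add_right, hS.evalTrunc_add DrinfeldKohnoTrunc.genSpan
    DrinfeldKohnoTrunc.list_prod_eq_zero_of_mem_genSpan (v₁ := ![x, y, 0]) (v₂ := ![0, z, 0])
    (fun i => by fin_cases i <;> simp [hx, hy]) (fun i => by fin_cases i <;> simp [hz])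
    (fun i j => by fin_cases i <;> fin_cases j <;> simp [hzx.symm, hzy.symm]),
    evalTrunc_vec3_single₁ hS]

/-! ### The two regularisation values used -/

omit [Algebra ℚ R] in
/-- `regEnd₀(0) = 0`: the end-regularised transports have no coefficient on the letter `0`.
[cite: IharaKanekoZagier2006, Cor. 5] -/
theorem regEnd_zero_singleton : Shuffle.regEnd (0 : Fin 3) [0] = 0 := by
  rw [Shuffle.regEnd]
  have : Shuffle.regFront (0 : Fin 3) [0] = 0 := by
    rw [Shuffle.regFront]
    have hl : Shuffle.leadCount (0 : Fin 3) [0] = 1 := by decide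
    rw [hl, Finset.sum_range_succ, Finset.sum_range_succ, Finset.sum_range_zero]
    simp [Shuffle.shuffleSum, Shuffle.wordSum]
  simp [this]

omit [Algebra ℚ R] in
/-- `regEnd₀(1) = 1` (a word not ending in `0` is untouched). [cite: IharaKanekoZagier2006, Cor. 5] -/
theorem regEnd_zero_singleton_one : Shuffle.regEnd (0 : Fin 3) [1] = Finsupp.single [1] 1 := by
  rw [Shuffle.regEnd, Shuffle.regFront]
  have hl : Shuffle.leadCount (0 : Fin 3) [1] = 0 := by decide
  rw [show ([1] : List (Fin 3)).reverse = [1] from rfl, hl, Finset.sum_range_succ, Finset.sum_range_zero]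
  simp [Shuffle.shuffleSum, Shuffle.wordSum]

/-! ### Drinfeld's telescoping, abstract group form -/

/-- **The telescoping lemma** (abstract group form of Drinfeld's argument): in a group, five
"edge" elements given as `Φ₁ = (m₇ e_c)⁻¹ (m₅ e_a)`, …, whose half-transports satisfy the five
corner identities and commute with the five central shifts, satisfy the pentagon
`Φ₅ Φ₄ = Φ₃ Φ₂ Φ₁`. [cite: Drinfeld1991, §2] -/
theorem pentagon_of_corners_group {G : Type} [Group G]
    (m0 m1 m2 m3 m4 m5 m6 m7 m8 m9 m10 m11 m12 m13 m14 ea ec ee eabc ede ecd ecde : G)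
    (c1 : m0 * m5 = m4 * m6) (c2 : m0 * m7 = m1 * m8) (c3 : m2 * m10 = m1 * m9)
    (c4 : m2 * m11 = m3 * m12) (c5 : m4 * m14 = m3 * m13)
    -- exponential identities
    (x1 : ede * ec = ecde) (x2 : ee * ecd = ecde)
    -- commutations
    (k1 : eabc * ec = ec * eabc) (k2 : eabc * m7 = m7 * eabc) (k3 : eabc * m5 = m5 * eabc)
    (k4 : ec * m8 = m8 * ec) (k5 : ec * m9 = m9 * ec) (k6 : ec * ede = ede * ec)
    (k7 : ecde * m10 = m10 * ecde) (k8 : ecde * m11 = m11 * ecde)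
    (k9 : ea * ee = ee * ea) (k10 : ea * m14 = m14 * ea) (k11 : ea * m6 = m6 * ea)
    (k12 : ea * eabc = eabc * ea)
    (k13 : ee * m13 = m13 * ee) (k14 : ee * m12 = m12 * ee) (k15 : ee * ecd = ecd * ee) :
    ((m12 * ecd)⁻¹ * (m13 * ea)) * ((m14 * ee)⁻¹ * (m6 * eabc)) =
      (m11⁻¹ * m10) * (((m9 * ede)⁻¹ * (m8 * eabc)) * ((m7 * ec)⁻¹ * (m5 * ea))) := by
  -- right-hand side
  have hR : (m11⁻¹ * m10) * (((m9 * ede)⁻¹ * (m8 * eabc)) * ((m7 * ec)⁻¹ * (m5 * ea))) =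
      ecde⁻¹ * (m12⁻¹ * (m3⁻¹ * (m4 * (m6 * (eabc * ea))))) := by
    -- corner substitutions as solved equations
    have s2 : m8 * m7⁻¹ = m1⁻¹ * m0 := by
      rw [eq_inv_mul_iff_mul_eq, ← mul_inv_eq_iff_eq_mul.mpr c2.symm]; group
    have s3 : m10 * m9⁻¹ = m2⁻¹ * m1 := by
      rw [eq_inv_mul_iff_mul_eq, ← mul_inv_eq_iff_eq_mul.mpr c3.symm]; group
    have s41 : m11⁻¹ * m2⁻¹ * m0 * m5 = m12⁻¹ * m3⁻¹ * m4 * m6 := by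
      have h1 : m11⁻¹ * m2⁻¹ = (m2 * m11)⁻¹ := by group
      have h2 : m12⁻¹ * m3⁻¹ = (m3 * m12)⁻¹ := by group
      rw [h1, h2, c4, mul_assoc, mul_assoc, c1]
    -- commutations in inverse form
    have k2' : eabc * m7⁻¹ = m7⁻¹ * eabc := by
      rw [eq_comm, inv_mul_eq_iff_eq_mul, ← mul_assoc, ← k2]; group
    have k1' : eabc * ec⁻¹ = ec⁻¹ * eabc := by
      rw [eq_comm, inv_mul_eq_iff_eq_mul, ← mul_assoc, ← k1]; group
    have k5' : ec⁻¹ * m9⁻¹ = m9⁻¹ * ec⁻¹ := by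
      have := congrArg (fun g => g⁻¹) k5; simp only [mul_inv_rev] at this; exact this.symm
    have k4' : ec⁻¹ * m8 = m8 * ec⁻¹ := by
      rw [inv_mul_eq_iff_eq_mul, ← mul_assoc, k4]; group
    have k6' : ede⁻¹ * ec⁻¹ = ec⁻¹ * ede⁻¹ := by
      have := congrArg (fun g => g⁻¹) k6; simp only [mul_inv_rev] at this; exact this
    have k7' : ecde⁻¹ * m10 = m10 * ecde⁻¹ := by
      rw [inv_mul_eq_iff_eq_mul, ← mul_assoc, k7]; group
    have k8' : ecde⁻¹ * m11⁻¹ = m11⁻¹ * ecde⁻¹ := by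
      have := congrArg (fun g => g⁻¹) k8; simp only [mul_inv_rev] at this; exact this.symm
    have hx1 : ede⁻¹ * ec⁻¹ = ecde⁻¹ := by rw [← x1, mul_inv_rev, k6']
    calc (m11⁻¹ * m10) * (((m9 * ede)⁻¹ * (m8 * eabc)) * ((m7 * ec)⁻¹ * (m5 * ea)))
        = m11⁻¹ * m10 * ede⁻¹ * m9⁻¹ * m8 * (eabc * ec⁻¹) * m7⁻¹ * m5 * ea := by group
      _ = m11⁻¹ * m10 * ede⁻¹ * m9⁻¹ * m8 * ec⁻¹ * (eabc * m7⁻¹) * m5 * ea := by rw [k1']; group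
      _ = m11⁻¹ * m10 * ede⁻¹ * m9⁻¹ * m8 * ec⁻¹ * m7⁻¹ * (eabc * m5) * ea := by rw [k2']; group
      _ = m11⁻¹ * m10 * ede⁻¹ * m9⁻¹ * (m8 * ec⁻¹) * m7⁻¹ * m5 * eabc * ea := by rw [k3]; group
      _ = m11⁻¹ * m10 * ede⁻¹ * (m9⁻¹ * ec⁻¹) * m8 * m7⁻¹ * m5 * eabc * ea := by rw [← k4']; group
      _ = m11⁻¹ * m10 * (ede⁻¹ * ec⁻¹) * m9⁻¹ * m8 * m7⁻¹ * m5 * eabc * ea := by rw [← k5']; group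
      _ = m11⁻¹ * (m10 * ecde⁻¹) * m9⁻¹ * m8 * m7⁻¹ * m5 * eabc * ea := by rw [hx1]; group
      _ = (m11⁻¹ * ecde⁻¹) * m10 * m9⁻¹ * m8 * m7⁻¹ * m5 * eabc * ea := by rw [← k7']; group
      _ = ecde⁻¹ * m11⁻¹ * (m10 * m9⁻¹) * (m8 * m7⁻¹) * m5 * eabc * ea := by rw [← k8']; group
      _ = ecde⁻¹ * (m11⁻¹ * m2⁻¹ * m0 * m5) * eabc * ea := by rw [s3, s2]; group
      _ = ecde⁻¹ * (m12⁻¹ * (m3⁻¹ * (m4 * (m6 * (eabc * ea))))) := by rw [s41]; group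
  -- left-hand side
  have hL : ((m12 * ecd)⁻¹ * (m13 * ea)) * ((m14 * ee)⁻¹ * (m6 * eabc)) =
      ecde⁻¹ * (m12⁻¹ * (m3⁻¹ * (m4 * (m6 * (eabc * ea))))) := by
    have s5 : m13 * m14⁻¹ = m3⁻¹ * m4 := by
      rw [eq_inv_mul_iff_mul_eq, ← mul_inv_eq_iff_eq_mul.mpr c5.symm]; group
    have k9' : ea * ee⁻¹ = ee⁻¹ * ea := by
      rw [eq_comm, inv_mul_eq_iff_eq_mul, ← mul_assoc, ← k9]; group
    have k10' : ea * m14⁻¹ = m14⁻¹ * ea := by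
      rw [eq_comm, inv_mul_eq_iff_eq_mul, ← mul_assoc, ← k10]; group
    have k13' : ee⁻¹ * m13 = m13 * ee⁻¹ := by
      rw [inv_mul_eq_iff_eq_mul, ← mul_assoc, k13]; group
    have k14' : ee⁻¹ * m12⁻¹ = m12⁻¹ * ee⁻¹ := by
      have := congrArg (fun g => g⁻¹) k14; simp only [mul_inv_rev] at this; exact this.symm
    have k15' : ecd⁻¹ * ee⁻¹ = ee⁻¹ * ecd⁻¹ := by
      have := congrArg (fun g => g⁻¹) k15; simp only [mul_inv_rev] at this; exact this
    have hx2 : ecd⁻¹ * ee⁻¹ = ecde⁻¹ := by rw [← x2, mul_inv_rev]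
    calc ((m12 * ecd)⁻¹ * (m13 * ea)) * ((m14 * ee)⁻¹ * (m6 * eabc))
        = ecd⁻¹ * m12⁻¹ * m13 * (ea * ee⁻¹) * m14⁻¹ * m6 * eabc := by group
      _ = ecd⁻¹ * m12⁻¹ * m13 * ee⁻¹ * (ea * m14⁻¹) * m6 * eabc := by rw [k9']; group
      _ = ecd⁻¹ * m12⁻¹ * m13 * ee⁻¹ * m14⁻¹ * (ea * m6) * eabc := by rw [k10']; group
      _ = ecd⁻¹ * m12⁻¹ * m13 * ee⁻¹ * m14⁻¹ * m6 * (ea * eabc) := by rw [k11]; group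
      _ = ecd⁻¹ * m12⁻¹ * (m13 * ee⁻¹) * m14⁻¹ * m6 * eabc * ea := by rw [k12]; group
      _ = ecd⁻¹ * (m12⁻¹ * ee⁻¹) * m13 * m14⁻¹ * m6 * eabc * ea := by rw [← k13']; group
      _ = (ecd⁻¹ * ee⁻¹) * m12⁻¹ * (m13 * m14⁻¹) * m6 * eabc * ea := by rw [← k14']; group
      _ = ecde⁻¹ * m12⁻¹ * (m3⁻¹ * m4) * m6 * eabc * ea := by rw [hx2, s5]
      _ = ecde⁻¹ * (m12⁻¹ * (m3⁻¹ * (m4 * (m6 * (eabc * ea))))) := by group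
  rw [hL, hR]

end Algebra

end Summit.KontsevichZagierPeriods.FurushoPentagon.PentagonInKZ
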